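import Mathlib
import Literature.Topology.FourManifolds.BalancedPresentation
import HarnessLib

/-!
# Grade-two dichotomy for KMN encoding graphs (Roe certificates), part 1/17: verbatim twins of the skeleton-local encoding

Verbatim twins of `Cruxes/DoublesShadowTwo/Lines/grade_two_ac.lean` §2–§3: the port tables of the figure-eight, melon
and handcuff blocks, `Piece`, and the encoding graph `ShadowGraph` with its uniform presentation `P(G)`.

THE FAMILY (16 modules `Theorems/RootDecompAEDoublesShadowTwoRoe*.lean` + the closing module
`Theorems/RootDecompAEDoublesShadowTwoStubGradeTwoDichotomy.lean`, one namespace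
`Summit.SmoothPoincare4.SmoothPoincare4.Theorems.RootDecompAEDoublesShadowTwoStubGradeTwoDichotomy`, chained imports,
split by topic to respect the 400-line bound on proof files; the local-table parts import only `…RoeDefs`).
-/

open Function
open Literature.Topology.FourManifolds

set_option linter.dupNamespace false

noncomputable section

namespace Summit.SmoothPoincare4.SmoothPoincare4.Theorems.RootDecompAEDoublesShadowTwoStubGradeTwoDichotomy

/-! ## §1 Verbatim twins of the skeleton-local definitions (`Cruxes/DoublesShadowTwo/Lines/grade_two_ac.lean` §2, §3, §4a, §4b) -/

/-- Spine letters `a, b, c` of a piece (three letters for every piece; a piece of rank `r` uses the first `r`). -/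
def la : FreeGroup (Fin 3) := FreeGroup.of 0
/-- Second spine letter. -/
def lb : FreeGroup (Fin 3) := FreeGroup.of 1
/-- Third spine letter (used only by the two-vertex blocks, rank 3). -/
def lc : FreeGroup (Fin 3) := FreeGroup.of 2

/-- PORT TABLE of the eleven figure-eight blocks (KMN Prop. 4.1; grade-one line §2, same numbering). -/
def x8Ports : Fin 11 → List (FreeGroup (Fin 3)) :=
  ![ [la, la * lb * la⁻¹ * lb⁻¹, lb],
     [la, la * lb * lb * la⁻¹ * lb⁻¹],
     [la, la * lb * la * lb⁻¹, lb],
     [la, la * lb * lb * la * lb⁻¹],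
     [la, la * lb⁻¹ * lb⁻¹ * la⁻¹ * lb⁻¹],
     [la, la * lb⁻¹, la * lb, lb],
     [la, la * lb⁻¹, la * lb * lb],
     [la * lb * lb * la⁻¹ * lb⁻¹ * la],
     [la * lb * lb * la * lb⁻¹ * la],
     [la * lb * lb * la, la * lb⁻¹],
     [la * lb * la, la * lb⁻¹ * lb⁻¹] ]

/-- PORT TABLE of the 57 MELON blocks (two true vertices joined by four singular edges `e₁, …, e₄`; sheets at a vertex =
2-subsets of the four edge germs; block = the four sheet bijections along the edges modulo `S₄ × S₄ × C₂`; port word =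
boundary circle of the regular neighbourhood read in `F₃ = ⟨x₁, x₂, x₃⟩`, `eᵢ ↦ xᵢ`, `e₄ ↦ 1`).  Index = position in
gen13 `enum/blocks2v2_melon.json` (sorted by number of ports, then words); ports per block 1–6. -/
def melonPorts : Fin 57 → List (FreeGroup (Fin 3)) :=
  ![[lb * lc⁻¹ * la * la * lc⁻¹ * lb⁻¹ * lc⁻¹ * lb * la⁻¹],
     [lb * lc⁻¹ * la * lc * lb * la * lc⁻¹ * lb * la⁻¹],
     [lb * lc⁻¹ * la⁻¹ * lc * la⁻¹ * lb⁻¹ * lc⁻¹ * lb * la⁻¹],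
     [lb * lc⁻¹ * la * lc⁻¹ * la⁻¹ * lb⁻¹ * lc⁻¹ * lb * la⁻¹],
     [lb * lc⁻¹ * la * lc * la⁻¹ * lb⁻¹ * lc⁻¹ * lb * la⁻¹],
     [lb * lc⁻¹ * la⁻¹ * lb⁻¹ * lc * la⁻¹ * lc * lb * la⁻¹],
     [lb * lc⁻¹ * la * lc⁻¹ * la⁻¹ * lb⁻¹ * lc * lb * la⁻¹],
     [lb * lc⁻¹ * la * lc * la⁻¹ * lb⁻¹ * lc * lb * la⁻¹],
     [lb * lc⁻¹ * la⁻¹ * lc * la * lc⁻¹ * lb * lb * la⁻¹],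
     [lb * lc⁻¹ * la * lc⁻¹ * lb⁻¹ * la⁻¹ * lc⁻¹ * lb * la⁻¹],
     [lb * lc⁻¹ * la * lb * lc * la⁻¹ * lc⁻¹ * lb * la⁻¹],
     [lb * lc⁻¹ * la * lc * la⁻¹ * lc⁻¹ * lb * lb * la⁻¹],
     [lb * lc⁻¹ * la * lb * la⁻¹ * lc⁻¹ * lb * lc * la⁻¹],
     [lb * lc⁻¹ * lb⁻¹ * lc⁻¹ * lb * la⁻¹, lc * la⁻¹ * la⁻¹],
     [lb * lc⁻¹ * la * lc⁻¹ * lc⁻¹ * lb * la⁻¹, lb⁻¹ * la⁻¹],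
     [lb * lc⁻¹ * lc⁻¹ * lb * la⁻¹, lc * la⁻¹ * lb⁻¹ * la⁻¹],
     [lb * lc⁻¹ * la * lc⁻¹ * lb * la⁻¹, lb⁻¹ * lc⁻¹ * la⁻¹],
     [lb * lc⁻¹ * lb * la⁻¹, lc * lb * la * lc⁻¹ * la⁻¹],
     [lb * la⁻¹, lc * lb⁻¹ * lc * lb * la * lc * la⁻¹],
     [lb * lc⁻¹ * la⁻¹ * lc * lb * la⁻¹, lb⁻¹ * lc * la⁻¹],
     [lb * lc⁻¹ * la * lc * lb * la⁻¹, lb⁻¹ * lc * la⁻¹],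
     [lb * la⁻¹, lc * lb⁻¹ * lc⁻¹ * la⁻¹ * lb⁻¹ * lc * la⁻¹],
     [lb * lc⁻¹ * la * lc * la⁻¹, lb⁻¹ * lc * lb * la⁻¹],
     [lb * la⁻¹, lc * la⁻¹ * lb⁻¹ * lc * lb * lc⁻¹ * la⁻¹],
     [lb * la⁻¹, lc * lb⁻¹ * lc⁻¹ * lb * la * lc * la⁻¹],
     [lb * la⁻¹, lc * lb⁻¹ * lc⁻¹ * lb * la * lc⁻¹ * la⁻¹],
     [lb * la⁻¹, lc * la⁻¹ * lb⁻¹ * lc * lc * lb⁻¹ * la⁻¹],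
     [lb * lc⁻¹ * la * lb * la⁻¹, lc⁻¹ * lb⁻¹ * lc * la⁻¹],
     [lb * lc⁻¹ * lb * lb * la⁻¹, lc * la * lc⁻¹ * la⁻¹],
     [lb * lc⁻¹ * la * lc⁻¹ * la⁻¹ * lc⁻¹ * lb * la⁻¹, lb⁻¹],
     [lb * la⁻¹, lc * lb⁻¹ * lc * la * lb * lc * la⁻¹],
     [lb * la⁻¹, lc * la⁻¹ * lc⁻¹ * lb * lb * lc⁻¹ * la⁻¹],
     [lb * la⁻¹, lc * lb⁻¹ * lb⁻¹ * lc * la * lc * la⁻¹],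
     [lb * lc⁻¹ * la * lb * la⁻¹, lc⁻¹ * lb * lc * la⁻¹],
     [lb * la⁻¹, lc * lb⁻¹ * la⁻¹ * lc⁻¹ * lb * lc * la⁻¹],
     [lb * la⁻¹, lc * la⁻¹ * la⁻¹, lc * lb * lc⁻¹ * lb⁻¹],
     [lb * lc⁻¹ * la * lc⁻¹ * lb * la⁻¹, lb⁻¹ * la⁻¹, lc⁻¹],
     [lb * lc⁻¹ * lb * la⁻¹, lc * lc * la⁻¹, lb⁻¹ * la⁻¹],
     [lb * la⁻¹, lc * lb⁻¹ * lc * la⁻¹, lb⁻¹ * lc⁻¹ * la⁻¹],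
     [lb * la⁻¹, lc * la⁻¹, lb⁻¹ * lc⁻¹ * lb * lc⁻¹ * la⁻¹],
     [lb * la⁻¹, lc * lb⁻¹ * lc⁻¹ * la⁻¹, lb⁻¹ * lc * la⁻¹],
     [lb * la⁻¹, lc * lb⁻¹ * la⁻¹ * lb⁻¹ * lc * la⁻¹, lc⁻¹],
     [lb * la⁻¹, lc * la⁻¹, lb⁻¹ * lc * lb * lc⁻¹ * la⁻¹],
     [lb * la⁻¹, lc * la⁻¹, lb⁻¹ * lc * lc * lb⁻¹ * la⁻¹],
     [lb * la⁻¹, lc * lb⁻¹ * lb⁻¹ * lc * la⁻¹, lc⁻¹ * la⁻¹],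
     [lb * la⁻¹, lc * la * lc * la⁻¹, lc * lb⁻¹ * lb⁻¹],
     [lb * lc * la⁻¹, lc * lb⁻¹ * la⁻¹, lc⁻¹ * lb * la⁻¹],
     [lb * la⁻¹, lc * lb⁻¹ * la⁻¹, lc⁻¹ * lb * lc * la⁻¹],
     [lb * la⁻¹, lc * la⁻¹, la⁻¹, lc * lb * lc * lb⁻¹],
     [lb * la⁻¹, lc * la⁻¹, la⁻¹, lc * lb * lc⁻¹ * lb⁻¹],
     [lb * la⁻¹, lc * la⁻¹, lb⁻¹ * la⁻¹, lc * lc * lb⁻¹],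
     [lb * la⁻¹, lc * lb⁻¹ * lc * la⁻¹, lb⁻¹ * la⁻¹, lc⁻¹],
     [lb * la⁻¹, lc * la⁻¹, lb⁻¹ * lc⁻¹ * la⁻¹, lc * lb⁻¹],
     [lb * la⁻¹, lc * lb⁻¹ * la⁻¹, lb⁻¹ * lc * la⁻¹, lc⁻¹],
     [lb * la⁻¹, lc * la⁻¹, lc⁻¹ * lb * lc⁻¹ * la⁻¹, lb⁻¹],
     [lb * la⁻¹, lc * la⁻¹, la⁻¹, lc * lb⁻¹, lc⁻¹ * lb⁻¹],
     [lb * la⁻¹, lc * la⁻¹, la⁻¹, lc * lb⁻¹, lb⁻¹, lc⁻¹] ]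

/-- PORT TABLE of the 116 HANDCUFF blocks (a loop `ℓ₁` at the first vertex, a loop `ℓ₂` at the second, two edges `c, d`
between them; `F₃ = ⟨a, b, c⟩` with `ℓ₁ ↦ a`, `c ↦ b`, `d ↦ 1`, `ℓ₂ ↦ c`).  Index = position in gen13
`enum/blocks2v2_handcuff.json`; ports per block 1–5. -/
def handcuffPorts : Fin 116 → List (FreeGroup (Fin 3)) :=
  ![[la⁻¹ * lc⁻¹ * lb⁻¹ * la * lb⁻¹ * lc * lc * lb⁻¹ * la⁻¹],
     [la⁻¹ * lc⁻¹ * lb⁻¹ * la * lc * lc * lb⁻¹ * lb⁻¹ * la⁻¹],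
     [la⁻¹ * lc⁻¹ * lb⁻¹ * lc * lc * lb⁻¹ * la * lb⁻¹ * la⁻¹],
     [la⁻¹ * lb * lc⁻¹ * lc⁻¹ * la⁻¹ * lc⁻¹ * lb⁻¹ * lb⁻¹ * la⁻¹],
     [la⁻¹ * lb * lc⁻¹ * lc⁻¹ * la * lc⁻¹ * lb⁻¹ * lb⁻¹ * la⁻¹],
     [la⁻¹ * lb * lc⁻¹ * lc⁻¹ * lb * lc * la⁻¹ * lb⁻¹ * la⁻¹],
     [la⁻¹ * lb * lc⁻¹ * lc⁻¹ * lb * lc * la * lb⁻¹ * la⁻¹],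
     [la⁻¹ * lb * lc * la⁻¹ * lb⁻¹ * lc * lc * lb⁻¹ * la⁻¹],
     [la⁻¹ * lb * lc * la⁻¹ * lc * lc * lb⁻¹ * lb⁻¹ * la⁻¹],
     [la⁻¹ * lb * lc * lb⁻¹ * lc⁻¹ * lc⁻¹ * la * lb⁻¹ * la⁻¹],
     [la⁻¹ * lb * lc * lb⁻¹ * lc * lc * la⁻¹ * lb⁻¹ * la⁻¹],
     [la⁻¹ * lb * lc * lb⁻¹ * lc * lc * la * lb⁻¹ * la⁻¹],
     [la⁻¹ * lb * lc * la * lb⁻¹ * lc * lc * lb⁻¹ * la⁻¹],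
     [la⁻¹ * lb * lc * la * lc * lc * lb⁻¹ * lb⁻¹ * la⁻¹],
     [la⁻¹ * lb * lc * lb * la⁻¹ * lc * lc * lb⁻¹ * la⁻¹],
     [la⁻¹ * lb * lc * lb * lc⁻¹ * lc⁻¹ * la⁻¹ * lb⁻¹ * la⁻¹],
     [la⁻¹ * lb * lc * lb * lc⁻¹ * lc⁻¹ * la * lb⁻¹ * la⁻¹],
     [la⁻¹ * lb * lc * lb * la * lc * lc * lb⁻¹ * la⁻¹],
     [la⁻¹ * lb * lc * lc * lb⁻¹ * lc⁻¹ * la * lb⁻¹ * la⁻¹],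
     [la⁻¹ * lb * lc * lc * lb⁻¹ * lc * la⁻¹ * lb⁻¹ * la⁻¹],
     [la⁻¹ * lb * lc * lc * lb⁻¹ * lc * la * lb⁻¹ * la⁻¹],
     [la⁻¹ * lc * lc * lb⁻¹ * lc⁻¹ * lb⁻¹ * la * lb⁻¹ * la⁻¹],
     [la⁻¹ * lc * lc * lb⁻¹ * la * lb⁻¹ * lc⁻¹ * lb⁻¹ * la⁻¹],
     [la⁻¹, lb * lc * lb * lc⁻¹ * lc⁻¹ * la⁻¹ * lb⁻¹ * la⁻¹],
     [la⁻¹, lb * lc * lc * lb⁻¹ * lc⁻¹ * la⁻¹ * lb⁻¹ * la⁻¹],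
     [la⁻¹, lb * lc * lc * lb⁻¹ * lc * la⁻¹ * lb⁻¹ * la⁻¹],
     [la⁻¹, lb * lc * lb * la * lc * lc * lb⁻¹ * la⁻¹],
     [la⁻¹, lb * lc * lb * la * lb * lc⁻¹ * lc⁻¹ * la⁻¹],
     [la⁻¹, lb * lc * la⁻¹ * lb⁻¹ * lc * lc * lb⁻¹ * la⁻¹],
     [la⁻¹, lb * lc * lc * lb⁻¹ * lb⁻¹ * la⁻¹ * lc⁻¹ * la⁻¹],
     [la⁻¹, lb * lc * la * lb * lc⁻¹ * lc⁻¹ * lb * la⁻¹],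
     [la⁻¹, lb * lc * la * lb⁻¹ * lc * lc * lb⁻¹ * la⁻¹],
     [la⁻¹, lb * lc * lc * lb⁻¹ * la⁻¹ * lc⁻¹ * lb * la⁻¹],
     [la⁻¹, lb * lc * lc * lb⁻¹ * lc * la * lb * la⁻¹],
     [la⁻¹, lb * lc * lc * lb⁻¹ * lc * la * lb⁻¹ * la⁻¹],
     [la⁻¹, lb * lc * lb * la⁻¹ * lc * lc * lb⁻¹ * la⁻¹],
     [la⁻¹, lb * lc * lb * lc⁻¹ * lc⁻¹ * la * lb⁻¹ * la⁻¹],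
     [la⁻¹, lb * lc * lb * lc⁻¹ * lc⁻¹ * la * lb * la⁻¹],
     [la⁻¹, lb * lc * lc * lb⁻¹ * la⁻¹ * lc * lb * la⁻¹],
     [la⁻¹, lb * lc * lc * lb⁻¹ * lb⁻¹ * la⁻¹ * lc * la⁻¹],
     [la⁻¹, lb * lc * lc * lb⁻¹ * lc⁻¹ * la * lb⁻¹ * la⁻¹],
     [la⁻¹, lb * lc * lc * lb⁻¹ * lc⁻¹ * la * lb * la⁻¹],
     [la⁻¹ * lb⁻¹ * lc * lc * lb⁻¹ * la⁻¹, lb * lc * la⁻¹],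
     [la⁻¹ * lc⁻¹ * lb⁻¹ * la⁻¹, lb * lc⁻¹ * lc⁻¹ * lb * la⁻¹],
     [la⁻¹ * lc⁻¹ * lb⁻¹ * la * lb⁻¹ * la⁻¹, lc * lc * lb⁻¹],
     [la⁻¹ * lc⁻¹ * lb⁻¹ * la * lc * lc * lb⁻¹ * la⁻¹, lb⁻¹],
     [la⁻¹ * lb * lc⁻¹ * lc⁻¹ * la⁻¹ * lb⁻¹ * la⁻¹, lc⁻¹ * lb⁻¹],
     [la⁻¹ * lb * lc⁻¹ * lc⁻¹ * la * lb⁻¹ * la⁻¹, lc⁻¹ * lb⁻¹],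
     [la⁻¹ * lb * lc * la⁻¹ * lb⁻¹ * la⁻¹, lc * lc * lb⁻¹],
     [la⁻¹ * lb * lc * la⁻¹ * lc * lc * lb⁻¹ * la⁻¹, lb⁻¹],
     [la⁻¹ * lb * lc * lb⁻¹ * la⁻¹, lc⁻¹ * lc⁻¹ * lb * la⁻¹],
     [la⁻¹ * lb * lc * lb⁻¹ * la⁻¹, lc * lc * lb * la⁻¹],
     [la⁻¹ * lb * lc * la * lb⁻¹ * la⁻¹, lc * lc * lb⁻¹],
     [la⁻¹ * lb * lc * la * lc * lc * lb⁻¹ * la⁻¹, lb⁻¹],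
     [la⁻¹ * lb * lc * lc * lb⁻¹ * la⁻¹, lc⁻¹ * lb * la⁻¹],
     [la⁻¹ * lb * lc * lc * lb⁻¹ * la⁻¹, lc * lb * la⁻¹],
     [la⁻¹ * lb * lc * lc * lb⁻¹ * lb⁻¹ * la⁻¹, lc⁻¹ * la⁻¹],
     [la⁻¹ * lb * lc * lc * lb⁻¹ * lb⁻¹ * la⁻¹, lc * la⁻¹],
     [la⁻¹ * lc * lc * lb⁻¹ * la⁻¹, lb * lc * lb * la⁻¹],
     [la⁻¹ * lc * lc * lb⁻¹ * la * lb⁻¹ * la⁻¹, lc⁻¹ * lb⁻¹],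
     [la⁻¹, lb * lc * lb * lc⁻¹ * lc⁻¹ * la⁻¹, lb⁻¹ * la⁻¹],
     [la⁻¹, lb * lc * lc * lb⁻¹ * lc⁻¹ * la⁻¹, lb⁻¹ * la⁻¹],
     [la⁻¹, lb * lc * lc * lb⁻¹ * lc * la⁻¹, lb⁻¹ * la⁻¹],
     [la⁻¹, lb * lc⁻¹ * lc⁻¹ * la⁻¹ * lb⁻¹ * la⁻¹, lc⁻¹ * lb⁻¹],
     [la⁻¹, lb * lc * la⁻¹ * lb⁻¹ * la⁻¹, lc * lc * lb⁻¹],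
     [la⁻¹, lb * lc * lb⁻¹ * lc * la⁻¹ * lb⁻¹ * la⁻¹, lc⁻¹],
     [la⁻¹, lb * lc * lb * lc⁻¹ * la⁻¹ * lb⁻¹ * la⁻¹, lc⁻¹],
     [la⁻¹, lb * lc * la⁻¹, lb⁻¹ * lc * lc * lb⁻¹ * la⁻¹],
     [la⁻¹, lb * lc * lc * lb⁻¹ * lb⁻¹ * la⁻¹, lc⁻¹ * la⁻¹],
     [la⁻¹, lb * lc * lc * lb⁻¹ * la⁻¹ * lc⁻¹ * la⁻¹, lb⁻¹],
     [la⁻¹, lb * lc * la * lb * la⁻¹, lc * lc * lb⁻¹],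
     [la⁻¹, lb * lc * la * lb * lc⁻¹ * lb * la⁻¹, lc⁻¹],
     [la⁻¹, lb * lc * la * lb⁻¹ * la⁻¹, lc * lc * lb⁻¹],
     [la⁻¹, lb * lc * la * lc * lc * lb⁻¹ * la⁻¹, lb⁻¹],
     [la⁻¹, lb * lc * la * lb⁻¹ * lc * lb⁻¹ * la⁻¹, lc⁻¹],
     [la⁻¹, lb * lc * la * lb * lc⁻¹ * lc⁻¹ * la⁻¹, lb⁻¹],
     [la⁻¹, lb * lc * lc * lb⁻¹ * la⁻¹, lc⁻¹ * lb * la⁻¹],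
     [la⁻¹, lb * lc * lb⁻¹ * lc * la * lb⁻¹ * la⁻¹, lc⁻¹],
     [la⁻¹, lb * lc⁻¹ * lc⁻¹ * la * lb⁻¹ * la⁻¹, lc⁻¹ * lb⁻¹],
     [la⁻¹, lb * lc⁻¹ * lc⁻¹ * la * lb * la⁻¹, lc⁻¹ * lb⁻¹],
     [la⁻¹, lb * lc * la⁻¹ * lc * lc * lb⁻¹ * la⁻¹, lb⁻¹],
     [la⁻¹, lb * lc * lb⁻¹ * lc⁻¹ * la * lb⁻¹ * la⁻¹, lc⁻¹],
     [la⁻¹, lb * lc * lb * la⁻¹, lc * lc * lb⁻¹ * la⁻¹],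
     [la⁻¹, lb * lc * lb * la⁻¹ * lc * lb⁻¹ * la⁻¹, lc⁻¹],
     [la⁻¹, lb * lc * lb * lc⁻¹ * la * lb⁻¹ * la⁻¹, lc⁻¹],
     [la⁻¹, lb * lc * lb * lc⁻¹ * la * lb * la⁻¹, lc⁻¹],
     [la⁻¹, lb * lc * lc * lb⁻¹ * la⁻¹, lc * lb * la⁻¹],
     [la⁻¹, lb * lc * lc * lb⁻¹ * la⁻¹ * lc * la⁻¹, lb⁻¹],
     [la⁻¹, lb * lc * lc * lb⁻¹ * lb⁻¹ * la⁻¹, lc * la⁻¹],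
     [la⁻¹ * lb⁻¹ * la⁻¹, lb * lc⁻¹ * lc⁻¹ * la⁻¹, lc⁻¹ * lb⁻¹],
     [la⁻¹ * lb⁻¹ * la⁻¹, lb * lc * la⁻¹, lc * lc * lb⁻¹],
     [la⁻¹ * lc⁻¹ * lb⁻¹ * la⁻¹, lb * lc⁻¹ * lc⁻¹ * la⁻¹, lb⁻¹],
     [la⁻¹ * lb * lc * lb⁻¹ * la⁻¹, lc⁻¹ * lc⁻¹ * la⁻¹, lb⁻¹],
     [la⁻¹ * lb * lc * lb⁻¹ * la⁻¹, lc * lc * la⁻¹, lb⁻¹],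
     [la⁻¹ * lb * lc * lc * lb⁻¹ * la⁻¹, lc⁻¹ * la⁻¹, lb⁻¹],
     [la⁻¹ * lb * lc * lc * lb⁻¹ * la⁻¹, lc * la⁻¹, lb⁻¹],
     [la⁻¹ * lc * lc * lb⁻¹ * la⁻¹, lb * la⁻¹, lc⁻¹ * lb⁻¹],
     [la⁻¹ * lc * lc * lb⁻¹ * la⁻¹, lb * lc * la⁻¹, lb⁻¹],
     [la⁻¹, lb * lc⁻¹ * lc⁻¹ * la⁻¹, lb⁻¹ * la⁻¹, lc⁻¹ * lb⁻¹],
     [la⁻¹, lb * lc * la⁻¹, lb⁻¹ * la⁻¹, lc * lc * lb⁻¹],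
     [la⁻¹, lb * lc * la⁻¹ * lb⁻¹ * la⁻¹, lc * lb⁻¹, lc⁻¹],
     [la⁻¹, lb * lc * lc * lb⁻¹ * la⁻¹, lc⁻¹ * la⁻¹, lb⁻¹],
     [la⁻¹, lb * lc * la * lb * la⁻¹, lc * lb⁻¹, lc⁻¹],
     [la⁻¹, lb * lc * la * lb⁻¹ * la⁻¹, lc * lb⁻¹, lc⁻¹],
     [la⁻¹, lb * lc * la * lc * lb⁻¹ * la⁻¹, lb⁻¹, lc⁻¹],
     [la⁻¹, lb * lc * la * lb * lc⁻¹ * la⁻¹, lb⁻¹, lc⁻¹],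
     [la⁻¹, lb * lc * lb⁻¹ * la⁻¹, lc⁻¹ * lb * la⁻¹, lc⁻¹],
     [la⁻¹, lb * lc * la⁻¹, lc * lc * lb⁻¹ * la⁻¹, lb⁻¹],
     [la⁻¹, lb * lc * la⁻¹ * lc * lb⁻¹ * la⁻¹, lb⁻¹, lc⁻¹],
     [la⁻¹, lb * lc * lb⁻¹ * la⁻¹, lc * lb * la⁻¹, lc⁻¹],
     [la⁻¹, lb * lc * lb * la⁻¹, lc * lb⁻¹ * la⁻¹, lc⁻¹],
     [la⁻¹, lb * lc * lc * lb⁻¹ * la⁻¹, lc * la⁻¹, lb⁻¹],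
     [la⁻¹, lb * lc * la⁻¹, lb⁻¹ * la⁻¹, lc * lb⁻¹, lc⁻¹],
     [la⁻¹, lb * lc * lb⁻¹ * la⁻¹, lc⁻¹ * la⁻¹, lb⁻¹, lc⁻¹],
     [la⁻¹, lb * lc * la⁻¹, lc * lb⁻¹ * la⁻¹, lb⁻¹, lc⁻¹],
     [la⁻¹, lb * lc * lb⁻¹ * la⁻¹, lc * la⁻¹, lb⁻¹, lc⁻¹] ]

/-- The pieces of a simple polyhedron of connected complexity ≤ 2: KMN's grade ≤ 1 pieces and the 57 + 116 two-vertex blocks. -/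
inductive Piece : Type
  | disc
  | pants
  | moebius
  | y111
  | y12
  | y3
  | x8 (i : Fin 11)
  | melon (i : Fin 57)
  | handcuff (i : Fin 116)
  deriving DecidableEq

namespace Piece

/-- Rank of the free fundamental group of the piece's spine (point, circle, figure-eight, 2-vertex 4-regular graph). -/
def rank : Piece → ℕ
  | disc => 0
  | pants => 2
  | moebius => 1
  | y111 => 1
  | y12 => 1
  | y3 => 1
  | x8 _ => 2
  | melon _ => 3
  | handcuff _ => 3

/-- Port words of every piece (as in the grade-one line, with the two block tables added). -/
def ports : Piece → List (FreeGroup (Fin 3))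
  | disc => [1]
  | pants => [la, lb, la * lb]
  | moebius => [la * la]
  | y111 => [la, la, la]
  | y12 => [la, la * la]
  | y3 => [la * la * la]
  | x8 i => x8Ports i
  | melon i => melonPorts i
  | handcuff i => handcuffPorts i

/-- Number of boundary circles (ports) of a piece. -/
def numPorts (p : Piece) : ℕ := p.ports.length

/-- The `j`-th port word of a piece (junk value `1` out of range). -/
def portWord (p : Piece) (j : ℕ) : FreeGroup (Fin 3) := p.ports.getD j 1

/-- Number of true vertices inside the piece (0, 1 for the figure-eight blocks, 2 for melons and handcuffs). -/
def numTrueVertices : Piece → ℕ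
  | x8 _ => 1
  | melon _ => 2
  | handcuff _ => 2
  | _ => 0

end Piece

/-- A KMN ENCODING GRAPH at connected complexity ≤ 2: `k` pieces, `m` glued port pairs with orientation signs, a chosen
spanning tree (same data as the grade-one line's `ShadowGraph`, over the larger piece type). -/
structure ShadowGraph where
  /-- number of pieces -/
  k : ℕ
  /-- number of glued port pairs -/
  m : ℕ
  /-- the piece at each vertex of the encoding graph -/
  piece : Fin k → Piece
  /-- first port of the `e`-th gluing: (piece index, port index) -/
  src : Fin m → Fin k × ℕ
  /-- second port of the `e`-th gluing -/
  tgt : Fin m → Fin k × ℕ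
  /-- gluing orientation of the `e`-th pair of boundary circles -/
  sgn : Fin m → Bool
  /-- the edges of the chosen spanning tree (their stable letters are killed) -/
  tree : Fin m → Bool

namespace ShadowGraph

variable (G : ShadowGraph)

/-- All `2m` port references used by the gluings. -/
def endpoints : Fin G.m ⊕ Fin G.m → Fin G.k × ℕ := Sum.elim G.src G.tgt

/-- Every referenced port exists. -/
def PortsValid : Prop :=
  ∀ e : Fin G.m, (G.src e).2 < (G.piece (G.src e).1).numPorts ∧ (G.tgt e).2 < (G.piece (G.tgt e).1).numPorts

/-- No boundary circle is glued twice. -/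
def PortsInjective : Prop := Function.Injective G.endpoints

/-- The simple graph on pieces spanned by the tree edges. -/
def treeAdj : SimpleGraph (Fin G.k) :=
  SimpleGraph.fromRel fun u v => ∃ e : Fin G.m, G.tree e = true ∧ (G.src e).1 = u ∧ (G.tgt e).1 = v

/-- The tree edges form a spanning tree of the encoding graph. -/
def IsSpanningTree : Prop :=
  (∀ e, G.tree e = true → (G.src e).1 ≠ (G.tgt e).1) ∧ G.treeAdj.Connected ∧
    (Finset.univ.filter fun e => G.tree e = true).card + 1 = G.k

/-- ADMISSIBLE encoding graphs: valid ports, no port glued twice, a genuine spanning tree.  (Connected complexity ≤ 2 is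
automatic: every block is a whole component of the singular set.) -/
def Admissible : Prop := G.PortsValid ∧ G.PortsInjective ∧ G.IsSpanningTree

/-- Number of true vertices of `X_G` (sub-grading; `≤ 2` per singular component by construction). -/
def numVertices : ℕ := ∑ v, (G.piece v).numTrueVertices

/-- GENERATORS: three spine letters per piece and one stable letter per glued pair. -/
abbrev Gen : Type := (Fin G.k × Fin 3) ⊕ Fin G.m

/-- RELATOR INDICES: one gluing relator per glued pair, one killing relator per tree edge, one killing relator per unused
spine letter `(v, i)` with `rank(piece v) ≤ i`. -/
abbrev Rel : Type := Fin G.m ⊕ {e : Fin G.m // G.tree e = true} ⊕ {p : Fin G.k × Fin 3 // (G.piece p.1).rank ≤ (p.2 : ℕ)}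

/-- The spine letters of piece `v` inside the big free group. -/
def embed (v : Fin G.k) : FreeGroup (Fin 3) →* FreeGroup G.Gen :=
  FreeGroup.map fun i => Sum.inl (v, i)

/-- The word of port `(v, j)` in the big free group. -/
def portWordAt (p : Fin G.k × ℕ) : FreeGroup G.Gen := G.embed p.1 ((G.piece p.1).portWord p.2)

/-- The stable letter of the `e`-th glued pair. -/
def stable (e : Fin G.m) : FreeGroup G.Gen := FreeGroup.of (Sum.inr e)

/-- The GLUING RELATOR of the `e`-th pair: `w_src · t_e · w_tgt^{±1} · t_e⁻¹`. -/
def gluingRelator (e : Fin G.m) : FreeGroup G.Gen :=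
  G.portWordAt (G.src e) * G.stable e * (if G.sgn e then G.portWordAt (G.tgt e) else (G.portWordAt (G.tgt e))⁻¹) *
    (G.stable e)⁻¹

/-- All relators of the uniform encoding. -/
def relator : G.Rel → FreeGroup G.Gen
  | Sum.inl e => G.gluingRelator e
  | Sum.inr (Sum.inl e) => G.stable e.1
  | Sum.inr (Sum.inr p) => FreeGroup.of (Sum.inl p.1)

/-- THE PRESENTATION `P(G)`, transported to `Fin n` along bijections of the index types (balanced iff `Σ_v rank = k − 1`). -/
def presentation {n : ℕ} (eg : G.Gen ≃ Fin n) (er : G.Rel ≃ Fin n) : BalancedPresentation n :=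
  fun j => FreeGroup.map eg (G.relator (er.symm j))

end ShadowGraph

end Summit.SmoothPoincare4.SmoothPoincare4.Theorems.RootDecompAEDoublesShadowTwoStubGradeTwoDichotomy
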